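import Literature.MathematicalPhysics.QuantumLattice.HubbardModelParticleHoleProofs
import HarnessLib

/-!
# Thermodynamic limit of the ground-state energy of the Hubbard ring: proofs

Family `hubbard` (trunk T-QLATTICE). Sibling proof file of
`Literature/MathematicalPhysics/QuantumLattice/HubbardModel.lean`, continuing
`HubbardModelParticleHoleProofs.lean` (whose Fock-space action lemmas it uses). It PROVES, from
Mathlib and the accepted definitions only, the existence of the thermodynamic limit of the
ground-state energy per site of the half-filled Hubbard ring — node F4
(`Literature.MathematicalPhysics.QuantumLattice.hubbardChain_energyPerSite_limit_exists`) of the Bethe-ansatz decomposition of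
`Literature.MathematicalPhysics.QuantumLattice.lieb_wu` (`LiebWuBetheAnsatz.lean`) — together with the generic graded-tensor-product
toolkit for lattice fermions that the subadditivity argument needs. No definition of the prelude is
changed and no definition is introduced (the occupation basis of an ordered disjoint union is
identified with the product of the two occupation bases inside the proof of
`sum_eq_sum_sum_filter`).

## Main results

* `Literature.MathematicalPhysics.QuantumLattice.ThermodynamicLimit.groundEnergyAt_le_add_of_cut`: if the (linearly ordered) site set of `G` is the
  ordered disjoint union of those of `G₁` (below) and `G₂` (above) along strictly monotone maps,
  and the adjacency of `G` restricted to block `i` differs from that of `G_i` on at most `k_i`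
  ordered pairs, then for all `t`, `U` and sectors `N_i ≤ 2|Λ_i|`,
  `E_G(N₁ + N₂) ≤ E_{G₁}(N₁) + E_{G₂}(N₂) + 2|t|(k₁ + k₂)` (`groundEnergyAt`, Wave0's variational
  sector energies).
* `Literature.MathematicalPhysics.QuantumLattice.ThermodynamicLimit.groundEnergyAt_ring_le_add`: for the rings (`fermionTorusGraph 1 L`),
  `E_{L₁+L₂}(N₁ + N₂) ≤ E_{L₁}(N₁) + E_{L₂}(N₂) + 8|t|`.
* `Literature.MathematicalPhysics.QuantumLattice.ThermodynamicLimit.neg_le_groundEnergyAt_ring`: `E_L(N) ≥ -4|t| L` for `U ≥ 0`.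
* `Literature.MathematicalPhysics.QuantumLattice.ThermodynamicLimit.tendsto_energyPerSite_ring`: for every `t` and `U ≥ 0`, `E_L(L)/L` converges as
  `L → ∞` (Fekete's lemma, Mathlib `Subadditive.tendsto_lim`, applied to `E_L(L) + 8|t|`);
  `Literature.MathematicalPhysics.QuantumLattice.ThermodynamicLimit.hubbardRing_energyPerSite_limit_exists`: the same along `L = 2n`, verbatim the
  statement of F4 (`hubbardChain L = fermionTorusGraph 1 L`) for any `t` (F4 has `t = 1`, `U > 0`).
* (The grading facts `IsNParticle.creation_mulVec` / `IsNParticle.annihilation_mulVec` of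
  `FermionOperators` are NOT discharged here — `IsNParticle.creation_mulVec_holds` lives in
  `FermionOperatorsProofs`; this file only uses its own sector lemmas
  `dotProduct_annihilation_mulVec_eq_zero`, `isNParticle_parityOp_mulVec`.)

All auxiliary lemmas live in the sub-namespaces `Literature.Hubbard.ThermodynamicLimit` and
`Literature.QLattice.ThermodynamicLimit` (so the main results are
`Literature.MathematicalPhysics.QuantumLattice.ThermodynamicLimit.groundEnergyAt_le_add_of_cut`, `…tendsto_energyPerSite_ring`,
`…hubbardRing_energyPerSite_limit_exists`).

## The graded tensor product (Jordan–Wigner bookkeeping)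

For orbital types `α` (lower block) and `β` (upper block) embedded into `γ` by strictly monotone
`f`, `g` with `f a < g b` for all `a, b` and `range f ∪ range g = γ`, the product vector
`(ψ₁ ⊗ ψ₂)(s) = ψ₁(f⁻¹ s) ψ₂(g⁻¹ s)` (written with the explicit preimage finsets
`{x | f x ∈ s}`) satisfies: `c_{f a}(ψ₁ ⊗ ψ₂) = (c_a ψ₁) ⊗ ψ₂`, `c†_{f a}` likewise
(`annihilation_low_mulVec_prodVec`, `creation_low_mulVec_prodVec`: below `f a` only the lower
block contributes to the Jordan–Wigner sign, `jwSign_apply_low`), and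
`c_{g b}(ψ₁ ⊗ ψ₂) = ((-1)^N ψ₁) ⊗ (c_b ψ₂)` (`annihilation_high_mulVec_prodVec`: the whole lower
block lies below `g b`, `jwSign_apply_high`). Hence inner products factorise
(`dotProduct_prodVec`), hopping amplitudes `⟨c_A Ψ, c_B Ψ⟩` inside a block reduce to the factor
(`dotProduct_annihilation_low_low`, `_high_high`, the parity twists cancel), hopping across the
cut has zero expectation in states of definite particle number (`_low_high`, `_high_low`), and
density–density terms factorise (`dotProduct_numberAt_numberAt_low`, `_high`).

## The ring

`fermionTorusGraph_one_adj_iff`: on `ℤ/Lℤ` with representatives `0 ≤ x < L`,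
`x ∼ y ↔ x ≠ y ∧ (y ≡ x + 1 ∨ x ≡ y + 1 mod L)`; every site has `≤ 2` neighbours, so there are
`≤ 2L` ordered bonds (`card_filter_fermionTorusGraph_one_adj_pair_le`). Cutting `ℤ/(L₁+L₂)ℤ` at
`L₁` (embeddings `Fin.castAdd`, `Fin.natAdd`), the induced adjacency on each block differs from
the ring adjacency of the block only on the ordered wrap-around pair(s) (`cut_low_wrap`,
`cut_high_wrap`), i.e. `k₁ = k₂ = 2`. With the bond bound `|⟨c_a ψ, c_b ψ⟩| ≤ 1`
(`norm_dotProduct_annihilation_le_one`, Cauchy–Schwarz in `ℓ²` and `‖c_a ψ‖² = ⟨ψ, n_a ψ⟩ ≤ 1`)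
and the expansion `⟨ψ, H ψ⟩ = -t Σ_{x∼y,σ} ⟨c_{xσ}ψ, c_{yσ}ψ⟩ + U Σ_x ⟨ψ, n_{x↑}n_{x↓} ψ⟩`
(`dotProduct_hamiltonian_mulVec`) this gives the ring cut, the a priori bound, and Fekete.

## Sources

D. Ruelle, *Statistical Mechanics: Rigorous Results* (1969), §2 (thermodynamic limit by
subadditivity); M. Fekete (1923) / Mathlib `Mathlib.Analysis.Subadditive`; E. H. Lieb, F. Y. Wu,
Physica A 321 (2003) 1, §2 (the rings `N_a = 2 × odd`; the limit along all even rings is the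
folklore complement recorded as F4 in `LiebWuBetheAnsatz.lean`). All statements here are
elementary finite-dimensional estimates ([folklore] tags on the individual lemmas).
-/

noncomputable section

open Matrix Finset
open scoped ComplexOrder BigOperators

namespace Literature.MathematicalPhysics.QuantumLattice.ThermodynamicLimit

section Product

variable {α β γ : Type*} [LinearOrder α] [Fintype α] [LinearOrder β] [Fintype β]
  [LinearOrder γ] [Fintype γ] {f : α → γ} {g : β → γ}

omit [Fintype γ] in
/-- Preimage of `insert (f a) s` along an injective `f`. [folklore] -/
theorem filter_apply_mem_insert_apply (hf : Function.Injective f) (s : Finset γ) (a : α) :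
    ({x | f x ∈ insert (f a) s} : Finset α) = insert a ({x | f x ∈ s} : Finset α) := by
  ext x
  simp [hf.eq_iff]

omit [Fintype γ] in
/-- Preimage of `s.erase (f a)` along an injective `f`. [folklore] -/
theorem filter_apply_mem_erase_apply (hf : Function.Injective f) (s : Finset γ) (a : α) :
    ({x | f x ∈ s.erase (f a)} : Finset α) = ({x | f x ∈ s} : Finset α).erase a := by
  ext x
  simp [hf.eq_iff]

omit [LinearOrder α] [Fintype γ] in
/-- Preimage of `insert c s` for `c` outside the range. [folklore] -/
theorem filter_apply_mem_insert_of_ne {c : γ} (h : ∀ a, f a ≠ c) (s : Finset γ) :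
    ({x | f x ∈ insert c s} : Finset α) = ({x | f x ∈ s} : Finset α) := by
  ext x
  simp [h x]

omit [LinearOrder α] [Fintype γ] in
/-- Preimage of `s.erase c` for `c` outside the range. [folklore] -/
theorem filter_apply_mem_erase_of_ne {c : γ} (h : ∀ a, f a ≠ c) (s : Finset γ) :
    ({x | f x ∈ s.erase c} : Finset α) = ({x | f x ∈ s} : Finset α) := by
  ext x
  simp [h x]

omit [LinearOrder α] [LinearOrder β] [Fintype γ] in
/-- A finset of the ordered disjoint union is the disjoint union of (the images of) its two
preimages. [folklore] -/
theorem eq_map_filter_union_map_filter (hf : Function.Injective f) (hg : Function.Injective g)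
    (hcov : ∀ c, (∃ a, f a = c) ∨ ∃ b, g b = c) (s : Finset γ) :
    s = ({x | f x ∈ s} : Finset α).map ⟨f, hf⟩ ∪ ({y | g y ∈ s} : Finset β).map ⟨g, hg⟩ := by
  ext c
  simp only [Finset.mem_union, Finset.mem_map, Finset.mem_filter, Finset.mem_univ, true_and,
    Function.Embedding.coeFn_mk]
  constructor
  · intro hc
    rcases hcov c with ⟨a, rfl⟩ | ⟨b, rfl⟩
    · exact Or.inl ⟨a, hc, rfl⟩
    · exact Or.inr ⟨b, hc, rfl⟩
  · rintro (⟨a, ha, rfl⟩ | ⟨b, hb, rfl⟩) <;> assumption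

omit [LinearOrder α] [Fintype α] [LinearOrder β] [Fintype β] [LinearOrder γ] [Fintype γ] in
/-- The two images are disjoint when the ranges are. [folklore] -/
theorem disjoint_map_filter (hf : Function.Injective f) (hg : Function.Injective g)
    (hne : ∀ a b, f a ≠ g b) (s₁ : Finset α) (s₂ : Finset β) :
    Disjoint (s₁.map ⟨f, hf⟩) (s₂.map ⟨g, hg⟩) := by
  rw [Finset.disjoint_left]
  simp only [Finset.mem_map, Function.Embedding.coeFn_mk]
  rintro c ⟨a, -, rfl⟩ ⟨b, -, hb⟩
  exact hne a b hb.symm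

omit [LinearOrder α] [LinearOrder β] [Fintype γ] in
/-- Cardinality splits over the two preimages. [folklore] -/
theorem card_eq_card_filter_add_card_filter (hf : Function.Injective f) (hg : Function.Injective g)
    (hne : ∀ a b, f a ≠ g b) (hcov : ∀ c, (∃ a, f a = c) ∨ ∃ b, g b = c) (s : Finset γ) :
    s.card = ({x | f x ∈ s} : Finset α).card + ({y | g y ∈ s} : Finset β).card := by
  conv_lhs => rw [eq_map_filter_union_map_filter hf hg hcov s]
  rw [Finset.card_union_of_disjoint (disjoint_map_filter hf hg hne _ _), Finset.card_map,
    Finset.card_map]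

omit [LinearOrder α] [LinearOrder β] in
/-- Sums over the occupation basis of the union factor through the product basis. [folklore] -/
theorem sum_eq_sum_sum_filter (hf : Function.Injective f) (hg : Function.Injective g)
    (hne : ∀ a b, f a ≠ g b) (hcov : ∀ c, (∃ a, f a = c) ∨ ∃ b, g b = c)
    (F : Finset α → Finset β → ℂ) :
    ∑ s : Finset γ, F {x | f x ∈ s} {y | g y ∈ s} = ∑ s₁ : Finset α, ∑ s₂ : Finset β, F s₁ s₂ := by
  rw [← Fintype.sum_prod_type']
  -- the occupation basis of the ordered disjoint union is the product of the two occupation bases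
  let e : Finset γ ≃ Finset α × Finset β :=
    { toFun := fun s => (({x | f x ∈ s} : Finset α), ({y | g y ∈ s} : Finset β))
      invFun := fun p => p.1.map ⟨f, hf⟩ ∪ p.2.map ⟨g, hg⟩
      left_inv := fun s => (eq_map_filter_union_map_filter hf hg hcov s).symm
      right_inv := fun p => by
        rcases p with ⟨s₁, s₂⟩
        ext x
        · simp only [Finset.mem_filter, Finset.mem_univ, true_and, Finset.mem_union,
            Finset.mem_map, Function.Embedding.coeFn_mk]
          constructor
          · rintro (⟨a, ha, h⟩ | ⟨b, -, h⟩)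
            · rwa [← hf h]
            · exact absurd h (hne x b).symm
          · exact fun hx => Or.inl ⟨x, hx, rfl⟩
        · simp only [Finset.mem_filter, Finset.mem_univ, true_and, Finset.mem_union,
            Finset.mem_map, Function.Embedding.coeFn_mk]
          constructor
          · rintro (⟨a, -, h⟩ | ⟨b, hb, h⟩)
            · exact absurd h (hne a x)
            · rwa [← hg h]
          · exact fun hx => Or.inr ⟨x, hx, rfl⟩ }
  exact Fintype.sum_equiv e _ _ fun s => rfl

omit [LinearOrder α] [LinearOrder β] in
/-- Inner products of product vectors factorise:
`⟨ψ₁ ⊗ ψ₂, φ₁ ⊗ φ₂⟩ = ⟨ψ₁, φ₁⟩ ⟨ψ₂, φ₂⟩`. [folklore] -/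
theorem dotProduct_prodVec (hf : Function.Injective f) (hg : Function.Injective g)
    (hne : ∀ a b, f a ≠ g b) (hcov : ∀ c, (∃ a, f a = c) ∨ ∃ b, g b = c)
    (ψ₁ φ₁ : Fock α) (ψ₂ φ₂ : Fock β) :
    star (fun s : Finset γ => ψ₁ {x | f x ∈ s} * ψ₂ {y | g y ∈ s}) ⬝ᵥ
        (fun s : Finset γ => φ₁ {x | f x ∈ s} * φ₂ {y | g y ∈ s}) =
      (star ψ₁ ⬝ᵥ φ₁) * (star ψ₂ ⬝ᵥ φ₂) := by
  simp only [dotProduct, Pi.star_apply, star_mul']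
  rw [Finset.sum_mul_sum]
  rw [← sum_eq_sum_sum_filter hf hg hne hcov
    (fun s₁ s₂ => star (ψ₁ s₁) * φ₁ s₁ * (star (ψ₂ s₂) * φ₂ s₂))]
  exact Finset.sum_congr rfl fun s _ => by ring

omit [LinearOrder β] [Fintype β] [Fintype γ] in
/-- Jordan–Wigner sign at an orbital of the lower block: only the lower block contributes.
[folklore] -/
theorem jwSign_apply_low (hf : StrictMono f) (hfg : ∀ a b, f a < g b)
    (hcov : ∀ c, (∃ a, f a = c) ∨ ∃ b, g b = c) (a : α) (r : Finset γ) :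
    jwSign (f a) r = jwSign a {x | f x ∈ r} := by
  unfold jwSign
  congr 1
  have h : r.filter (· < f a) =
      (({x | f x ∈ r} : Finset α).filter (· < a)).map ⟨f, hf.injective⟩ := by
    ext j
    simp only [Finset.mem_filter, Finset.mem_map, Finset.mem_univ, true_and,
      Function.Embedding.coeFn_mk]
    constructor
    · rintro ⟨hj, hlt⟩
      rcases hcov j with ⟨x, rfl⟩ | ⟨b, rfl⟩
      · exact ⟨x, ⟨hj, hf.lt_iff_lt.1 hlt⟩, rfl⟩
      · exact absurd hlt (not_lt.2 (hfg a b).le)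
    · rintro ⟨x, ⟨hx, hlt⟩, rfl⟩
      exact ⟨hx, hf hlt⟩
  rw [h, Finset.card_map]

omit [Fintype γ] in
/-- Jordan–Wigner sign at an orbital of the upper block: the whole lower block contributes its
parity. [folklore] -/
theorem jwSign_apply_high (hf : StrictMono f) (hg : StrictMono g) (hfg : ∀ a b, f a < g b)
    (hcov : ∀ c, (∃ a, f a = c) ∨ ∃ b, g b = c) (b : β) (r : Finset γ) :
    jwSign (g b) r = (-1) ^ ({x | f x ∈ r} : Finset α).card * jwSign b {y | g y ∈ r} := by
  unfold jwSign
  rw [← pow_add]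
  congr 1
  have hne : ∀ a b, f a ≠ g b := fun a b => (hfg a b).ne
  have h : r.filter (· < g b) =
      ({x | f x ∈ r} : Finset α).map ⟨f, hf.injective⟩ ∪
        (({y | g y ∈ r} : Finset β).filter (· < b)).map ⟨g, hg.injective⟩ := by
    ext j
    simp only [Finset.mem_filter, Finset.mem_union, Finset.mem_map, Finset.mem_univ, true_and,
      Function.Embedding.coeFn_mk]
    constructor
    · rintro ⟨hj, hlt⟩
      rcases hcov j with ⟨x, rfl⟩ | ⟨y, rfl⟩
      · exact Or.inl ⟨x, hj, rfl⟩
      · exact Or.inr ⟨y, ⟨hj, hg.lt_iff_lt.1 hlt⟩, rfl⟩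
    · rintro (⟨x, hx, rfl⟩ | ⟨y, ⟨hy, hlt⟩, rfl⟩)
      · exact ⟨hx, hfg x b⟩
      · exact ⟨hy, hg hlt⟩
  rw [h, Finset.card_union_of_disjoint (disjoint_map_filter hf.injective hg.injective hne _ _),
    Finset.card_map, Finset.card_map]

omit [LinearOrder β] in
/-- `c_{f a} (ψ₁ ⊗ ψ₂) = (c_a ψ₁) ⊗ ψ₂`. [folklore] -/
theorem annihilation_low_mulVec_prodVec (hf : StrictMono f) (hfg : ∀ a b, f a < g b)
    (hcov : ∀ c, (∃ a, f a = c) ∨ ∃ b, g b = c) (ψ₁ : Fock α) (ψ₂ : Fock β) (a : α) :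
    annihilation (f a) *ᵥ (fun s : Finset γ => ψ₁ {x | f x ∈ s} * ψ₂ {y | g y ∈ s}) =
      fun s : Finset γ => (annihilation a *ᵥ ψ₁) {x | f x ∈ s} * ψ₂ {y | g y ∈ s} := by
  have hne : ∀ a b, f a ≠ g b := fun a b => (hfg a b).ne
  funext s
  rw [annihilation_mulVec_apply, annihilation_mulVec_apply]
  by_cases h : f a ∈ s
  · have h' : a ∈ ({x | f x ∈ s} : Finset α) := (Finset.mem_filter_univ a).2 h
    rw [if_neg (not_not_intro h), if_neg (not_not_intro h'), zero_mul]
  · have h' : a ∉ ({x | f x ∈ s} : Finset α) := fun h'' => h ((Finset.mem_filter_univ a).1 h'')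
    rw [if_pos h, if_pos h', jwSign_apply_low hf hfg hcov, filter_apply_mem_insert_apply hf.injective,
      filter_apply_mem_insert_of_ne (fun b => (hne a b).symm)]
    ring

omit [LinearOrder β] in
/-- `c†_{f a} (ψ₁ ⊗ ψ₂) = (c†_a ψ₁) ⊗ ψ₂`. [folklore] -/
theorem creation_low_mulVec_prodVec (hf : StrictMono f) (hfg : ∀ a b, f a < g b)
    (hcov : ∀ c, (∃ a, f a = c) ∨ ∃ b, g b = c) (ψ₁ : Fock α) (ψ₂ : Fock β) (a : α) :
    creation (f a) *ᵥ (fun s : Finset γ => ψ₁ {x | f x ∈ s} * ψ₂ {y | g y ∈ s}) =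
      fun s : Finset γ => (creation a *ᵥ ψ₁) {x | f x ∈ s} * ψ₂ {y | g y ∈ s} := by
  have hne : ∀ a b, f a ≠ g b := fun a b => (hfg a b).ne
  funext s
  rw [creation_mulVec_apply, creation_mulVec_apply]
  by_cases h : f a ∈ s
  · have h' : a ∈ ({x | f x ∈ s} : Finset α) := (Finset.mem_filter_univ a).2 h
    rw [if_pos h, if_pos h', jwSign_apply_low hf hfg hcov, filter_apply_mem_erase_apply hf.injective,
      filter_apply_mem_erase_of_ne (fun b => (hne a b).symm)]
    ring
  · have h' : a ∉ ({x | f x ∈ s} : Finset α) := fun h'' => h ((Finset.mem_filter_univ a).1 h'')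
    rw [if_neg h, if_neg h', zero_mul]

/-- `c_{g b} (ψ₁ ⊗ ψ₂) = ((-1)^N ψ₁) ⊗ (c_b ψ₂)`. [folklore] -/
theorem annihilation_high_mulVec_prodVec (hf : StrictMono f) (hg : StrictMono g)
    (hfg : ∀ a b, f a < g b) (hcov : ∀ c, (∃ a, f a = c) ∨ ∃ b, g b = c)
    (ψ₁ : Fock α) (ψ₂ : Fock β) (b : β) :
    annihilation (g b) *ᵥ (fun s : Finset γ => ψ₁ {x | f x ∈ s} * ψ₂ {y | g y ∈ s}) =
      fun s : Finset γ =>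
        (Literature.MathematicalPhysics.QuantumLattice.parityOp *ᵥ ψ₁) {x | f x ∈ s} * (annihilation b *ᵥ ψ₂) {y | g y ∈ s} := by
  have hne : ∀ a b, f a ≠ g b := fun a b => (hfg a b).ne
  funext s
  rw [annihilation_mulVec_apply, annihilation_mulVec_apply, Literature.MathematicalPhysics.QuantumLattice.parityOp, mulVec_diagonal]
  by_cases h : g b ∈ s
  · have h' : b ∈ ({y | g y ∈ s} : Finset β) := (Finset.mem_filter_univ b).2 h
    rw [if_neg (not_not_intro h), if_neg (not_not_intro h'), mul_zero]
  · have h' : b ∉ ({y | g y ∈ s} : Finset β) := fun h'' => h ((Finset.mem_filter_univ b).1 h'')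
    rw [if_pos h, if_pos h', jwSign_apply_high hf hg hfg hcov,
      filter_apply_mem_insert_apply hg.injective, filter_apply_mem_insert_of_ne (hne · b)]
    ring

/-- `c†_{g b} (ψ₁ ⊗ ψ₂) = ((-1)^N ψ₁) ⊗ (c†_b ψ₂)`. [folklore] -/
theorem creation_high_mulVec_prodVec (hf : StrictMono f) (hg : StrictMono g)
    (hfg : ∀ a b, f a < g b) (hcov : ∀ c, (∃ a, f a = c) ∨ ∃ b, g b = c)
    (ψ₁ : Fock α) (ψ₂ : Fock β) (b : β) :
    creation (g b) *ᵥ (fun s : Finset γ => ψ₁ {x | f x ∈ s} * ψ₂ {y | g y ∈ s}) =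
      fun s : Finset γ =>
        (Literature.MathematicalPhysics.QuantumLattice.parityOp *ᵥ ψ₁) {x | f x ∈ s} * (creation b *ᵥ ψ₂) {y | g y ∈ s} := by
  have hne : ∀ a b, f a ≠ g b := fun a b => (hfg a b).ne
  funext s
  rw [creation_mulVec_apply, creation_mulVec_apply, Literature.MathematicalPhysics.QuantumLattice.parityOp, mulVec_diagonal]
  by_cases h : g b ∈ s
  · have h' : b ∈ ({y | g y ∈ s} : Finset β) := (Finset.mem_filter_univ b).2 h
    rw [if_pos h, if_pos h', jwSign_apply_high hf hg hfg hcov,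
      filter_apply_mem_erase_apply hg.injective, filter_apply_mem_erase_of_ne (hne · b)]
    ring
  · have h' : b ∉ ({y | g y ∈ s} : Finset β) := fun h'' => h ((Finset.mem_filter_univ b).1 h'')
    rw [if_neg h, if_neg h', mul_zero]

/-- `((-1)^N)² = 1`. [folklore] -/
theorem parityOp_mulVec_parityOp_mulVec {κ : Type*} [LinearOrder κ] [Fintype κ] (ψ : Fock κ) :
    Literature.MathematicalPhysics.QuantumLattice.parityOp *ᵥ (Literature.MathematicalPhysics.QuantumLattice.parityOp *ᵥ ψ) = ψ := by
  funext s
  rw [Literature.MathematicalPhysics.QuantumLattice.parityOp, mulVec_diagonal, mulVec_diagonal, ← mul_assoc, ← pow_add,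
    ← two_mul, pow_mul]
  norm_num

/-- Vectors in different particle-number sectors are orthogonal. [folklore] -/
theorem dotProduct_eq_zero_of_isNParticle_ne {κ : Type*} [Fintype κ] {N M : ℕ} {ψ φ : Fock κ}
    (hψ : IsNParticle N ψ) (hφ : IsNParticle M φ) (h : N ≠ M) : star ψ ⬝ᵥ φ = 0 := by
  rw [dotProduct]
  refine Finset.sum_eq_zero fun s _ => ?_
  by_cases hs : s.card = N
  · rw [hφ s (hs ▸ h), mul_zero]
  · rw [Pi.star_apply, hψ s hs, star_zero, zero_mul]

/-- The parity operator preserves every particle-number sector. [folklore] -/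
theorem isNParticle_parityOp_mulVec {κ : Type*} [LinearOrder κ] [Fintype κ] {N : ℕ} {ψ : Fock κ}
    (hψ : IsNParticle N ψ) : IsNParticle N (Literature.MathematicalPhysics.QuantumLattice.parityOp *ᵥ ψ) := by
  intro s hs
  rw [Literature.MathematicalPhysics.QuantumLattice.parityOp, mulVec_diagonal, hψ s hs, mul_zero]

end Product

end Literature.MathematicalPhysics.QuantumLattice.ThermodynamicLimit


/-! ### The Hubbard ring: sites, adjacency, and the two blocks of a cut -/

namespace Literature.MathematicalPhysics.QuantumLattice.ThermodynamicLimit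


section Ring

/-- Ring sites are determined by their coordinate. [folklore] -/
theorem fermionTorus_one_ext {L : ℕ} {x y : FermionTorus 1 L} (h : ofLex x 0 = ofLex y 0) : x = y :=
  ofLex.injective (funext fun i => by rwa [Fin.fin_one_eq_zero i])

/-- Ring sites are determined by the value of their coordinate. [folklore] -/
theorem fermionTorus_one_ext_val {L : ℕ} {x y : FermionTorus 1 L}
    (h : (ofLex x 0 : ℕ) = ofLex y 0) : x = y :=
  fermionTorus_one_ext (Fin.ext h)

/-- Adjacency on the ring `ℤ/Lℤ` in terms of representatives `0 ≤ x, y < L`: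
`x ∼ y ↔ x ≠ y ∧ (y ≡ x + 1 ∨ x ≡ y + 1 (mod L))`. Friedli–Velenik (2017) §3.1. [folklore] -/
theorem fermionTorusGraph_one_adj_iff {L : ℕ} (x y : FermionTorus 1 L) :
    (fermionTorusGraph 1 L).Adj x y ↔ (ofLex x 0 : ℕ) ≠ ofLex y 0 ∧
      (((ofLex x 0 : ℕ) + 1) % L = ofLex y 0 ∨ ((ofLex y 0 : ℕ) + 1) % L = ofLex x 0) := by
  rw [fermionTorusGraph_adj, Literature.Probability.LatticeModels.torusGraph_adj_iff]
  have key : ∀ u v : FermionTorus 1 L,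
      FermionTorus.toTorusSite v = FermionTorus.toTorusSite u + Pi.single 0 1 ↔
        ((ofLex u 0 : ℕ) + 1) % L = ofLex v 0 := by
    intro u v
    rw [funext_iff, Fin.forall_fin_one, Pi.add_apply, FermionTorus.toTorusSite_apply,
      FermionTorus.toTorusSite_apply, Pi.single_eq_same, eq_comm, ← Nat.cast_succ,
      ZMod.natCast_eq_natCast_iff', Nat.mod_eq_of_lt (ofLex v 0).isLt]
  have hne : FermionTorus.toTorusSite x ≠ FermionTorus.toTorusSite y ↔
      (ofLex x 0 : ℕ) ≠ ofLex y 0 := by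
    rw [Ne, Ne, funext_iff, Fin.forall_fin_one, FermionTorus.toTorusSite_apply,
      FermionTorus.toTorusSite_apply, ZMod.natCast_eq_natCast_iff', Nat.mod_eq_of_lt (ofLex x 0).isLt,
      Nat.mod_eq_of_lt (ofLex y 0).isLt]
  rw [hne, Fin.exists_fin_one, Fin.exists_fin_one, key, key]

/-- An elementary fact on representatives: `y + 1 ≡ x (mod L)` with `x, y < L` forces
`y = (x + (L - 1)) mod L`. [folklore] -/
theorem eq_mod_of_succ_mod_eq {L x y : ℕ} (hx : x < L) (hy : y < L) (h : (y + 1) % L = x) :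
    y = (x + (L - 1)) % L := by
  rcases Nat.lt_or_ge (y + 1) L with h1 | h1
  · rw [Nat.mod_eq_of_lt h1] at h
    have : x + (L - 1) = y + L := by omega
    rw [this, Nat.add_mod_right, Nat.mod_eq_of_lt hy]
  · have h2 : y + 1 = L := by omega
    rw [h2, Nat.mod_self] at h
    subst h
    rw [zero_add, Nat.mod_eq_of_lt (by omega)]
    omega

/-- Every ring site has at most two neighbours. [folklore] -/
theorem card_filter_fermionTorusGraph_one_adj_le_two {L : ℕ} (x : FermionTorus 1 L) :
    #{y | (fermionTorusGraph 1 L).Adj x y} ≤ 2 := by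
  calc #{y | (fermionTorusGraph 1 L).Adj x y}
      ≤ #({((ofLex x 0 : ℕ) + 1) % L, ((ofLex x 0 : ℕ) + (L - 1)) % L} : Finset ℕ) := by
        refine Finset.card_le_card_of_injOn (fun y => (ofLex y 0 : ℕ)) ?_ ?_
        · intro y hy
          rw [Finset.mem_coe, Finset.mem_filter] at hy
          obtain ⟨-, h | h⟩ := (fermionTorusGraph_one_adj_iff x y).1 hy.2
          · rw [Finset.coe_insert, Finset.coe_singleton, Set.mem_insert_iff, Set.mem_singleton_iff]
            exact Or.inl h.symm
          · rw [Finset.coe_insert, Finset.coe_singleton, Set.mem_insert_iff, Set.mem_singleton_iff]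
            exact Or.inr (eq_mod_of_succ_mod_eq (ofLex x 0).isLt (ofLex y 0).isLt h)
        · intro y _ y' _ h
          exact fermionTorus_one_ext_val h
    _ ≤ 2 := Finset.card_le_two

/-- The ordered adjacent pairs of the ring number at most `2L`. [folklore] -/
theorem card_filter_fermionTorusGraph_one_adj_pair_le {L : ℕ} :
    #{p : FermionTorus 1 L × FermionTorus 1 L | (fermionTorusGraph 1 L).Adj p.1 p.2} ≤ 2 * L := by
  calc #{p : FermionTorus 1 L × FermionTorus 1 L | (fermionTorusGraph 1 L).Adj p.1 p.2}
      = ∑ x : FermionTorus 1 L, #{y | (fermionTorusGraph 1 L).Adj x y} := by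
        rw [← Finset.card_sigma]
        refine Finset.card_bij' (fun p _ => ⟨p.1, p.2⟩) (fun q _ => (q.1, q.2)) ?_ ?_ ?_ ?_
        · intro p hp
          simpa using hp
        · intro q hq
          simpa using hq
        · intro p _; rfl
        · intro q _; rfl
    _ ≤ ∑ _x : FermionTorus 1 L, 2 := Finset.sum_le_sum fun x _ =>
        card_filter_fermionTorusGraph_one_adj_le_two x
    _ = 2 * L := by
        rw [Finset.sum_const, Finset.card_univ, smul_eq_mul, mul_comm]
        simp [FermionTorus, Fintype.card_lex]

/-- Arithmetic of the cut, lower block: inside `{0, …, L₁ - 1} ⊆ ℤ/(L₁+L₂)ℤ` the ring adjacency of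
`ℤ/(L₁+L₂)ℤ` and that of `ℤ/L₁ℤ` differ at most on the pair `{0, L₁ - 1}`. [folklore] -/
theorem cut_low_wrap {L₁ L₂ a b : ℕ} (ha : a < L₁) (hb : b < L₁)
    (h : ¬ ((a ≠ b ∧ ((a + 1) % (L₁ + L₂) = b ∨ (b + 1) % (L₁ + L₂) = a)) ↔
      (a ≠ b ∧ ((a + 1) % L₁ = b ∨ (b + 1) % L₁ = a)))) :
    (a = 0 ∧ b = L₁ - 1) ∨ (a = L₁ - 1 ∧ b = 0) := by
  rcases Nat.eq_zero_or_pos L₂ with rfl | hL₂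
  · simp at h
  · rw [Nat.mod_eq_of_lt (by omega : a + 1 < L₁ + L₂),
      Nat.mod_eq_of_lt (by omega : b + 1 < L₁ + L₂)] at h
    rcases Nat.lt_or_ge (a + 1) L₁ with h1 | h1
    · rw [Nat.mod_eq_of_lt h1] at h
      rcases Nat.lt_or_ge (b + 1) L₁ with h2 | h2
      · rw [Nat.mod_eq_of_lt h2] at h
        exact absurd Iff.rfl h
      · have h3 : b + 1 = L₁ := by omega
        rw [h3, Nat.mod_self] at h
        omega
    · have h3 : a + 1 = L₁ := by omega
      rcases Nat.lt_or_ge (b + 1) L₁ with h2 | h2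
      · rw [Nat.mod_eq_of_lt h2, h3, Nat.mod_self] at h
        omega
      · omega

/-- Arithmetic of the cut, upper block: inside `{L₁, …, L₁ + L₂ - 1} ⊆ ℤ/(L₁+L₂)ℤ` the ring
adjacency of `ℤ/(L₁+L₂)ℤ` and that of (the translate of) `ℤ/L₂ℤ` differ at most on the pair
`{0, L₂ - 1}`. [folklore] -/
theorem cut_high_wrap {L₁ L₂ a b : ℕ} (ha : a < L₂) (hb : b < L₂)
    (h : ¬ ((L₁ + a ≠ L₁ + b ∧ ((L₁ + a + 1) % (L₁ + L₂) = L₁ + b ∨ (L₁ + b + 1) % (L₁ + L₂) = L₁ + a)) ↔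
      (a ≠ b ∧ ((a + 1) % L₂ = b ∨ (b + 1) % L₂ = a)))) :
    (a = 0 ∧ b = L₂ - 1) ∨ (a = L₂ - 1 ∧ b = 0) := by
  rcases Nat.eq_zero_or_pos L₁ with rfl | hL₁
  · simp at h
  · rcases Nat.lt_or_ge (a + 1) L₂ with h1 | h1
    · rw [Nat.mod_eq_of_lt h1, Nat.mod_eq_of_lt (by omega : L₁ + a + 1 < L₁ + L₂)] at h
      rcases Nat.lt_or_ge (b + 1) L₂ with h2 | h2
      · rw [Nat.mod_eq_of_lt h2, Nat.mod_eq_of_lt (by omega : L₁ + b + 1 < L₁ + L₂)] at h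
        exact absurd (by omega) h
      · have h3 : b + 1 = L₂ := by omega
        rw [h3, Nat.mod_self, show L₁ + b + 1 = L₁ + L₂ by omega, Nat.mod_self] at h
        omega
    · have h3 : a + 1 = L₂ := by omega
      rw [h3, Nat.mod_self, show L₁ + a + 1 = L₁ + L₂ by omega, Nat.mod_self] at h
      rcases Nat.lt_or_ge (b + 1) L₂ with h2 | h2
      · rw [Nat.mod_eq_of_lt h2, Nat.mod_eq_of_lt (by omega : L₁ + b + 1 < L₁ + L₂)] at h
        omega
      · omega

end Ring

end Literature.MathematicalPhysics.QuantumLattice.ThermodynamicLimit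


/-! ### Expectation values of local words in product states -/

namespace Literature.MathematicalPhysics.QuantumLattice.ThermodynamicLimit

section ProductExpect

variable {α β γ : Type*} [LinearOrder α] [Fintype α] [LinearOrder β] [Fintype β]
  [LinearOrder γ] [Fintype γ] {f : α → γ} {g : β → γ}

/-- `⟨ψ, c†_a c_b ψ⟩ = ⟨c_a ψ, c_b ψ⟩`. [folklore] -/
theorem dotProduct_creation_mul_annihilation_mulVec {κ : Type*} [LinearOrder κ] [Fintype κ]
    (a b : κ) (ψ : Fock κ) :
    star ψ ⬝ᵥ ((creation a * annihilation b) *ᵥ ψ) =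
      star (annihilation a *ᵥ ψ) ⬝ᵥ (annihilation b *ᵥ ψ) := by
  rw [← mulVec_mulVec, dotProduct_mulVec, creation, ← star_mulVec]

/-- The parity twist is norm-preserving: `⟨(-1)^N ψ, (-1)^N φ⟩ = ⟨ψ, φ⟩`. [folklore] -/
theorem dotProduct_parityOp_mulVec {κ : Type*} [LinearOrder κ] [Fintype κ] (ψ φ : Fock κ) :
    star (Literature.MathematicalPhysics.QuantumLattice.parityOp *ᵥ ψ) ⬝ᵥ (Literature.MathematicalPhysics.QuantumLattice.parityOp *ᵥ φ) = star ψ ⬝ᵥ φ := by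
  simp only [dotProduct, Pi.star_apply, Literature.MathematicalPhysics.QuantumLattice.parityOp, mulVec_diagonal, star_mul', star_pow,
    star_neg, star_one]
  refine Finset.sum_congr rfl fun s _ => ?_
  calc (-1) ^ s.card * star (ψ s) * ((-1) ^ s.card * φ s)
      = ((-1) ^ s.card * (-1) ^ s.card) * (star (ψ s) * φ s) := by ring
    _ = star (ψ s) * φ s := by rw [← pow_add, ← two_mul, pow_mul]; norm_num

/-- Annihilation lowers the particle number, so `⟨ψ', c_b ψ⟩ = 0` for `ψ, ψ'` in the same sector.
[folklore] -/
theorem dotProduct_annihilation_mulVec_eq_zero {κ : Type*} [LinearOrder κ] [Fintype κ] {N : ℕ}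
    {ψ ψ' : Fock κ} (hψ' : IsNParticle N ψ') (hψ : IsNParticle N ψ) (b : κ) :
    star ψ' ⬝ᵥ (annihilation b *ᵥ ψ) = 0 := by
  rw [dotProduct]
  refine Finset.sum_eq_zero fun s _ => ?_
  rw [Pi.star_apply, annihilation_mulVec_apply]
  by_cases hs : s.card = N
  · by_cases hb : b ∈ s
    · rw [if_neg (not_not_intro hb), mul_zero]
    · rw [if_pos hb, hψ _ (by rw [Finset.card_insert_of_notMem hb]; omega), mul_zero, mul_zero]
  · rw [hψ' s hs, star_zero, zero_mul]

/-- Hopping inside the lower block: `⟨c_{fa} Ψ, c_{fb} Ψ⟩ = ⟨c_a ψ₁, c_b ψ₁⟩ ⟨ψ₂, ψ₂⟩`. [folklore] -/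
theorem dotProduct_annihilation_low_low (hf : StrictMono f) (hg : StrictMono g)
    (hfg : ∀ a b, f a < g b) (hcov : ∀ c, (∃ a, f a = c) ∨ ∃ b, g b = c)
    (ψ₁ : Fock α) (ψ₂ : Fock β) (a b : α) :
    star (annihilation (f a) *ᵥ (fun s : Finset γ => ψ₁ {x | f x ∈ s} * ψ₂ {y | g y ∈ s})) ⬝ᵥ
        (annihilation (f b) *ᵥ (fun s : Finset γ => ψ₁ {x | f x ∈ s} * ψ₂ {y | g y ∈ s})) =
      (star (annihilation a *ᵥ ψ₁) ⬝ᵥ (annihilation b *ᵥ ψ₁)) * (star ψ₂ ⬝ᵥ ψ₂) := by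
  have hne : ∀ a b, f a ≠ g b := fun a b => (hfg a b).ne
  rw [annihilation_low_mulVec_prodVec hf hfg hcov, annihilation_low_mulVec_prodVec hf hfg hcov,
    dotProduct_prodVec hf.injective hg.injective hne hcov]

/-- Hopping inside the upper block: `⟨c_{gb} Ψ, c_{gb'} Ψ⟩ = ⟨ψ₁, ψ₁⟩ ⟨c_b ψ₂, c_b' ψ₂⟩`. [folklore] -/
theorem dotProduct_annihilation_high_high (hf : StrictMono f) (hg : StrictMono g)
    (hfg : ∀ a b, f a < g b) (hcov : ∀ c, (∃ a, f a = c) ∨ ∃ b, g b = c)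
    (ψ₁ : Fock α) (ψ₂ : Fock β) (b b' : β) :
    star (annihilation (g b) *ᵥ (fun s : Finset γ => ψ₁ {x | f x ∈ s} * ψ₂ {y | g y ∈ s})) ⬝ᵥ
        (annihilation (g b') *ᵥ (fun s : Finset γ => ψ₁ {x | f x ∈ s} * ψ₂ {y | g y ∈ s})) =
      (star ψ₁ ⬝ᵥ ψ₁) * (star (annihilation b *ᵥ ψ₂) ⬝ᵥ (annihilation b' *ᵥ ψ₂)) := by
  have hne : ∀ a b, f a ≠ g b := fun a b => (hfg a b).ne
  rw [annihilation_high_mulVec_prodVec hf hg hfg hcov, annihilation_high_mulVec_prodVec hf hg hfg hcov,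
    dotProduct_prodVec hf.injective hg.injective hne hcov, dotProduct_parityOp_mulVec]

/-- Hopping across the cut vanishes in a product of states with definite particle number (lower
to upper). [folklore] -/
theorem dotProduct_annihilation_low_high (hf : StrictMono f) (hg : StrictMono g)
    (hfg : ∀ a b, f a < g b) (hcov : ∀ c, (∃ a, f a = c) ∨ ∃ b, g b = c)
    {N₁ : ℕ} {ψ₁ : Fock α} (hψ₁ : IsNParticle N₁ ψ₁) (ψ₂ : Fock β) (a : α) (b : β) :
    star (annihilation (f a) *ᵥ (fun s : Finset γ => ψ₁ {x | f x ∈ s} * ψ₂ {y | g y ∈ s})) ⬝ᵥ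
        (annihilation (g b) *ᵥ (fun s : Finset γ => ψ₁ {x | f x ∈ s} * ψ₂ {y | g y ∈ s})) = 0 := by
  have hne : ∀ a b, f a ≠ g b := fun a b => (hfg a b).ne
  rw [annihilation_low_mulVec_prodVec hf hfg hcov, annihilation_high_mulVec_prodVec hf hg hfg hcov,
    dotProduct_prodVec hf.injective hg.injective hne hcov]
  have h0 : star (Literature.MathematicalPhysics.QuantumLattice.parityOp *ᵥ ψ₁) ⬝ᵥ (annihilation a *ᵥ ψ₁) = 0 :=
    dotProduct_annihilation_mulVec_eq_zero (isNParticle_parityOp_mulVec hψ₁) hψ₁ a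
  have h1 : star (annihilation a *ᵥ ψ₁) ⬝ᵥ (Literature.MathematicalPhysics.QuantumLattice.parityOp *ᵥ ψ₁) = 0 := by
    rw [← star_star (Literature.MathematicalPhysics.QuantumLattice.parityOp *ᵥ ψ₁), star_dotProduct_star, h0, star_zero]
  rw [h1, zero_mul]

/-- Hopping across the cut vanishes (upper to lower). [folklore] -/
theorem dotProduct_annihilation_high_low (hf : StrictMono f) (hg : StrictMono g)
    (hfg : ∀ a b, f a < g b) (hcov : ∀ c, (∃ a, f a = c) ∨ ∃ b, g b = c)
    {N₁ : ℕ} {ψ₁ : Fock α} (hψ₁ : IsNParticle N₁ ψ₁) (ψ₂ : Fock β) (a : α) (b : β) :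
    star (annihilation (g b) *ᵥ (fun s : Finset γ => ψ₁ {x | f x ∈ s} * ψ₂ {y | g y ∈ s})) ⬝ᵥ
        (annihilation (f a) *ᵥ (fun s : Finset γ => ψ₁ {x | f x ∈ s} * ψ₂ {y | g y ∈ s})) = 0 := by
  have hne : ∀ a b, f a ≠ g b := fun a b => (hfg a b).ne
  rw [annihilation_low_mulVec_prodVec hf hfg hcov, annihilation_high_mulVec_prodVec hf hg hfg hcov,
    dotProduct_prodVec hf.injective hg.injective hne hcov,
    dotProduct_annihilation_mulVec_eq_zero (isNParticle_parityOp_mulVec hψ₁) hψ₁ a, zero_mul]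

/-- Density–density terms inside the lower block factorise. [folklore] -/
theorem dotProduct_numberAt_numberAt_low (hf : StrictMono f) (hg : StrictMono g)
    (hfg : ∀ a b, f a < g b) (hcov : ∀ c, (∃ a, f a = c) ∨ ∃ b, g b = c)
    (ψ₁ : Fock α) (ψ₂ : Fock β) (a a' : α) :
    star (fun s : Finset γ => ψ₁ {x | f x ∈ s} * ψ₂ {y | g y ∈ s}) ⬝ᵥ
        (Literature.MathematicalPhysics.QuantumLattice.numberAt (f a) *ᵥ (Literature.MathematicalPhysics.QuantumLattice.numberAt (f a') *ᵥ
          (fun s : Finset γ => ψ₁ {x | f x ∈ s} * ψ₂ {y | g y ∈ s}))) =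
      (star ψ₁ ⬝ᵥ (Literature.MathematicalPhysics.QuantumLattice.numberAt a *ᵥ (Literature.MathematicalPhysics.QuantumLattice.numberAt a' *ᵥ ψ₁))) *
        (star ψ₂ ⬝ᵥ ψ₂) := by
  have hne : ∀ a b, f a ≠ g b := fun a b => (hfg a b).ne
  simp only [Literature.MathematicalPhysics.QuantumLattice.numberAt, ← mulVec_mulVec]
  rw [annihilation_low_mulVec_prodVec hf hfg hcov, creation_low_mulVec_prodVec hf hfg hcov,
    annihilation_low_mulVec_prodVec hf hfg hcov, creation_low_mulVec_prodVec hf hfg hcov,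
    dotProduct_prodVec hf.injective hg.injective hne hcov]

/-- Density–density terms inside the upper block factorise. [folklore] -/
theorem dotProduct_numberAt_numberAt_high (hf : StrictMono f) (hg : StrictMono g)
    (hfg : ∀ a b, f a < g b) (hcov : ∀ c, (∃ a, f a = c) ∨ ∃ b, g b = c)
    (ψ₁ : Fock α) (ψ₂ : Fock β) (b b' : β) :
    star (fun s : Finset γ => ψ₁ {x | f x ∈ s} * ψ₂ {y | g y ∈ s}) ⬝ᵥ
        (Literature.MathematicalPhysics.QuantumLattice.numberAt (g b) *ᵥ (Literature.MathematicalPhysics.QuantumLattice.numberAt (g b') *ᵥ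
          (fun s : Finset γ => ψ₁ {x | f x ∈ s} * ψ₂ {y | g y ∈ s}))) =
      (star ψ₁ ⬝ᵥ ψ₁) *
        (star ψ₂ ⬝ᵥ (Literature.MathematicalPhysics.QuantumLattice.numberAt b *ᵥ (Literature.MathematicalPhysics.QuantumLattice.numberAt b' *ᵥ ψ₂))) := by
  have hne : ∀ a b, f a ≠ g b := fun a b => (hfg a b).ne
  simp only [Literature.MathematicalPhysics.QuantumLattice.numberAt, ← mulVec_mulVec]
  rw [annihilation_high_mulVec_prodVec hf hg hfg hcov, creation_high_mulVec_prodVec hf hg hfg hcov,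
    parityOp_mulVec_parityOp_mulVec, annihilation_high_mulVec_prodVec hf hg hfg hcov,
    creation_high_mulVec_prodVec hf hg hfg hcov, parityOp_mulVec_parityOp_mulVec,
    dotProduct_prodVec hf.injective hg.injective hne hcov]

omit [Fintype γ] in
/-- The product of unit vectors in the sectors `N₁`, `N₂` lies in the sector `N₁ + N₂`.
[folklore] -/
theorem isNParticle_prodVec (hf : StrictMono f) (hg : StrictMono g) (hfg : ∀ a b, f a < g b)
    (hcov : ∀ c, (∃ a, f a = c) ∨ ∃ b, g b = c) {N₁ N₂ : ℕ} {ψ₁ : Fock α} {ψ₂ : Fock β}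
    (hψ₁ : IsNParticle N₁ ψ₁) (hψ₂ : IsNParticle N₂ ψ₂) :
    IsNParticle (N₁ + N₂) (fun s : Finset γ => ψ₁ {x | f x ∈ s} * ψ₂ {y | g y ∈ s}) := by
  have hne : ∀ a b, f a ≠ g b := fun a b => (hfg a b).ne
  intro s hs
  rw [card_eq_card_filter_add_card_filter hf.injective hg.injective hne hcov] at hs
  by_cases h1 : ({x | f x ∈ s} : Finset α).card = N₁
  · have h2 : ({y | g y ∈ s} : Finset β).card ≠ N₂ := fun h2 => hs (by rw [h1, h2])
    simp only [hψ₂ _ h2, mul_zero]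
  · simp only [hψ₁ _ h1, zero_mul]

end ProductExpect

/-! ### Expectation of the Hubbard Hamiltonian, bond bounds -/

section Expect

variable {Λ : Type*} [LinearOrder Λ] [Fintype Λ]

/-- For a unit vector, `Σ_s ‖ψ s‖² = 1`. [folklore] -/
theorem sum_norm_sq_eq_one_of_dotProduct_eq_one {κ : Type*} [Fintype κ] {ψ : κ → ℂ}
    (hψ : star ψ ⬝ᵥ ψ = 1) : ∑ i, ‖ψ i‖ ^ 2 = (1 : ℝ) := by
  have h2 : ∀ i, (star ψ) i * ψ i = ((‖ψ i‖ ^ 2 : ℝ) : ℂ) := fun i => by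
    rw [Pi.star_apply, Complex.star_def, Complex.conj_mul', Complex.ofReal_pow]
  rw [dotProduct] at hψ
  simp only [h2] at hψ
  exact_mod_cast hψ

/-- `⟨c_a ψ, c_a ψ⟩ = ⟨ψ, n_a ψ⟩ = Σ_{s ∋ a} ‖ψ s‖²` has real part at most `‖ψ‖² = 1`. [folklore] -/
theorem re_dotProduct_annihilation_self_le_one {κ : Type*} [LinearOrder κ] [Fintype κ] {ψ : Fock κ}
    (hψ : star ψ ⬝ᵥ ψ = 1) (a : κ) :
    (star (annihilation a *ᵥ ψ) ⬝ᵥ (annihilation a *ᵥ ψ)).re ≤ 1 := by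
  rw [← dotProduct_creation_mul_annihilation_mulVec, show creation a * annihilation a =
    Literature.MathematicalPhysics.QuantumLattice.numberAt a from rfl, Literature.MathematicalPhysics.QuantumLattice.numberAt_eq_diagonal]
  simp only [dotProduct, mulVec_diagonal, Pi.star_apply, Complex.re_sum]
  rw [← sum_norm_sq_eq_one_of_dotProduct_eq_one hψ]
  refine Finset.sum_le_sum fun s _ => ?_
  split_ifs
  · rw [one_mul, Complex.star_def, Complex.conj_mul', ← Complex.ofReal_pow, Complex.ofReal_re]
  · rw [zero_mul, mul_zero, Complex.zero_re]
    positivity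

/-- `⟨c_a ψ, c_a ψ⟩` is real and nonnegative (as a complex number, its real part is `≥ 0`).
[folklore] -/
theorem re_dotProduct_annihilation_self_nonneg {κ : Type*} [LinearOrder κ] [Fintype κ] (ψ : Fock κ)
    (a : κ) : 0 ≤ (star (annihilation a *ᵥ ψ) ⬝ᵥ (annihilation a *ᵥ ψ)).re := by
  simp only [dotProduct, Pi.star_apply, Complex.re_sum]
  refine Finset.sum_nonneg fun s _ => ?_
  rw [Complex.star_def, Complex.conj_mul', ← Complex.ofReal_pow, Complex.ofReal_re]
  positivity

/-- **Bond bound**: `|⟨c_a ψ, c_b ψ⟩| ≤ 1` for a unit vector (Cauchy–Schwarz and `‖c_a ψ‖ ≤ 1`).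
[folklore] -/
theorem norm_dotProduct_annihilation_le_one {κ : Type*} [LinearOrder κ] [Fintype κ] {ψ : Fock κ}
    (hψ : star ψ ⬝ᵥ ψ = 1) (a b : κ) :
    ‖star (annihilation a *ᵥ ψ) ⬝ᵥ (annihilation b *ᵥ ψ)‖ ≤ 1 := by
  have key : ∀ u v : Fock κ, star u ⬝ᵥ v =
      @inner ℂ _ _ (WithLp.toLp 2 u : EuclideanSpace ℂ (Finset κ)) (WithLp.toLp 2 v) := by
    intro u v
    rw [EuclideanSpace.inner_toLp_toLp, dotProduct_comm]
  have hnorm : ∀ u : Fock κ, ‖(WithLp.toLp 2 u : EuclideanSpace ℂ (Finset κ))‖ ^ 2 =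
      (star u ⬝ᵥ u).re := by
    intro u
    rw [key, ← inner_self_eq_norm_sq (𝕜 := ℂ)]
    rfl
  have hle : ∀ c : κ, ‖(WithLp.toLp 2 (annihilation c *ᵥ ψ) : EuclideanSpace ℂ (Finset κ))‖ ≤ 1 := by
    intro c
    rw [← sq_le_one_iff₀ (norm_nonneg _), hnorm]
    exact re_dotProduct_annihilation_self_le_one hψ c
  rw [key]
  calc ‖@inner ℂ _ _ (WithLp.toLp 2 (annihilation a *ᵥ ψ) : EuclideanSpace ℂ (Finset κ))
        (WithLp.toLp 2 (annihilation b *ᵥ ψ))‖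
      ≤ ‖(WithLp.toLp 2 (annihilation a *ᵥ ψ) : EuclideanSpace ℂ (Finset κ))‖ *
          ‖(WithLp.toLp 2 (annihilation b *ᵥ ψ) : EuclideanSpace ℂ (Finset κ))‖ :=
        norm_inner_le_norm _ _
    _ ≤ 1 * 1 := mul_le_mul (hle a) (hle b) (norm_nonneg _) zero_le_one
    _ = 1 := one_mul _

/-- The density–density expectation `⟨ψ, n_{x↑} n_{x↓} ψ⟩` is real and nonnegative. [folklore] -/
theorem re_dotProduct_numberOp_numberOp_nonneg (ψ : Fock (Orb Λ)) (x : Λ) :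
    0 ≤ (star ψ ⬝ᵥ (numberOp x 0 *ᵥ (numberOp x 1 *ᵥ ψ))).re := by
  rw [← Literature.MathematicalPhysics.QuantumLattice.numberAt_orb, ← Literature.MathematicalPhysics.QuantumLattice.numberAt_orb, Literature.MathematicalPhysics.QuantumLattice.numberAt_eq_diagonal,
    Literature.MathematicalPhysics.QuantumLattice.numberAt_eq_diagonal]
  simp only [dotProduct, mulVec_diagonal, Pi.star_apply, Complex.re_sum]
  refine Finset.sum_nonneg fun s _ => ?_
  split_ifs <;> simp only [one_mul, zero_mul, mul_zero, Complex.zero_re, le_refl]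
  rw [Complex.star_def, Complex.conj_mul', ← Complex.ofReal_pow, Complex.ofReal_re]
  positivity

variable (G : SimpleGraph Λ) [DecidableRel G.Adj]

/-- **Expectation of the Hubbard Hamiltonian**:
`⟨ψ, H ψ⟩ = -t Σ_{x ∼ y, σ} ⟨c_{xσ} ψ, c_{yσ} ψ⟩ + U Σ_x ⟨ψ, n_{x↑} n_{x↓} ψ⟩`. [folklore] -/
theorem dotProduct_hamiltonian_mulVec (t U : ℝ) (ψ : Fock (Orb Λ)) :
    star ψ ⬝ᵥ (hamiltonian G t U *ᵥ ψ) =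
      -(t : ℂ) * ∑ x : Λ, ∑ y : Λ, ∑ σ : Fin 2,
          (if G.Adj x y then star (annihilation (orb x σ) *ᵥ ψ) ⬝ᵥ (annihilation (orb y σ) *ᵥ ψ)
            else 0) +
        (U : ℂ) * ∑ x : Λ, star ψ ⬝ᵥ (numberOp x 0 *ᵥ (numberOp x 1 *ᵥ ψ)) := by
  unfold hamiltonian
  simp only [add_mulVec, smul_mulVec, Matrix.sum_mulVec, dotProduct_add, dotProduct_smul,
    dotProduct_sum, smul_eq_mul, ← mulVec_mulVec]
  congr 2
  · refine Finset.sum_congr rfl fun x _ => Finset.sum_congr rfl fun y _ =>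
      Finset.sum_congr rfl fun σ _ => ?_
    split_ifs with h
    · rw [dotProduct_creation_mul_annihilation_mulVec]
    · rw [zero_mulVec, dotProduct_zero]

omit [LinearOrder Λ] in
/-- Sums over the sites of a graph cut into a lower and an upper block. [folklore] -/
theorem sum_eq_sum_add_sum_of_cut {Λ₁ Λ₂ : Type*} [Fintype Λ₁] [Fintype Λ₂] {e₁ : Λ₁ → Λ}
    {e₂ : Λ₂ → Λ} (h₁ : Function.Injective e₁) (h₂ : Function.Injective e₂)
    (hne : ∀ x y, e₁ x ≠ e₂ y) (hcov : ∀ z, (∃ x, e₁ x = z) ∨ ∃ y, e₂ y = z) (φ : Λ → ℂ) :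
    ∑ z, φ z = ∑ x, φ (e₁ x) + ∑ y, φ (e₂ y) := by
  have hbij : Function.Bijective (Sum.elim e₁ e₂) := by
    constructor
    · rintro (x | y) (x' | y') h
      · have h' : e₁ x = e₁ x' := by simpa using h
        rw [h₁ h']
      · exact absurd (by simpa using h) (hne x y')
      · exact absurd (by simpa using h.symm) (hne x' y)
      · have h' : e₂ y = e₂ y' := by simpa using h
        rw [h₂ h']
    · intro z
      rcases hcov z with ⟨x, rfl⟩ | ⟨y, rfl⟩
      · exact ⟨Sum.inl x, rfl⟩
      · exact ⟨Sum.inr y, rfl⟩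
  rw [← (Equiv.ofBijective _ hbij).sum_comp, Fintype.sum_sum_type]
  simp

/-- **Few differing pairs**: if two adjacency patterns on `Λ₁` differ on at most `k` ordered pairs
and the bond amplitudes are bounded by `B`, the corresponding hopping sums differ by at most `k B`.
[folklore] -/
theorem norm_sum_ite_sub_sum_ite_le {Λ₁ : Type*} [Fintype Λ₁] (P Q : Λ₁ → Λ₁ → Prop)
    [DecidableRel P] [DecidableRel Q] (b : Λ₁ → Λ₁ → ℂ) {B : ℝ} (hB0 : 0 ≤ B)
    (hB : ∀ x y, ‖b x y‖ ≤ B) {k : ℕ} (hk : #{p : Λ₁ × Λ₁ | ¬ (P p.1 p.2 ↔ Q p.1 p.2)} ≤ k) :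
    ‖(∑ x, ∑ y, if P x y then b x y else 0) - ∑ x, ∑ y, if Q x y then b x y else 0‖ ≤ k * B := by
  · rw [← Finset.sum_sub_distrib]
    simp only [← Finset.sum_sub_distrib]
    rw [← Fintype.sum_prod_type' (f := fun x y => (if P x y then b x y else 0) - if Q x y then b x y else 0)]
    rw [← Finset.sum_filter_of_ne (p := fun p : Λ₁ × Λ₁ => ¬ (P p.1 p.2 ↔ Q p.1 p.2))]
    · calc ‖∑ p ∈ Finset.univ.filter (fun p : Λ₁ × Λ₁ => ¬ (P p.1 p.2 ↔ Q p.1 p.2)),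
            ((if P p.1 p.2 then b p.1 p.2 else 0) - if Q p.1 p.2 then b p.1 p.2 else 0)‖
          ≤ ∑ p ∈ Finset.univ.filter (fun p : Λ₁ × Λ₁ => ¬ (P p.1 p.2 ↔ Q p.1 p.2)),
            ‖(if P p.1 p.2 then b p.1 p.2 else 0) - if Q p.1 p.2 then b p.1 p.2 else 0‖ :=
            norm_sum_le _ _
        _ ≤ ∑ _p ∈ Finset.univ.filter (fun p : Λ₁ × Λ₁ => ¬ (P p.1 p.2 ↔ Q p.1 p.2)), B := by
            refine Finset.sum_le_sum fun p _ => ?_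
            split_ifs <;> simp [hB, hB0]
        _ ≤ k * B := by
            rw [Finset.sum_const, nsmul_eq_mul]
            exact mul_le_mul_of_nonneg_right (by exact_mod_cast hk) hB0
    · intro p _ hp
      by_contra hPQ
      apply hp
      by_cases hP : P p.1 p.2
      · rw [if_pos hP, if_pos (hPQ.1 hP), sub_self]
      · rw [if_neg hP, if_neg (fun hQ => hP (hPQ.2 hQ)), sub_self]

end Expect

end Literature.MathematicalPhysics.QuantumLattice.ThermodynamicLimit


/-! ### Subadditivity of sector ground-state energies under a cut of the graph -/

namespace Literature.MathematicalPhysics.QuantumLattice.ThermodynamicLimit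

section Sector

variable {κ : Type*} [LinearOrder κ] [Fintype κ]

/-- The variational set of the sector `N ≤ |κ|` is nonempty (a basis vector). [folklore] -/
theorem groundEnergySet_nonempty (H : Matrix (Finset κ) (Finset κ) ℂ) {N : ℕ}
    (hN : N ≤ Fintype.card κ) :
    {E : ℝ | ∃ ψ : Fock κ, IsNParticle N ψ ∧ star ψ ⬝ᵥ ψ = 1 ∧ E = (expect H ψ).re}.Nonempty := by
  have hcard : N ≤ (Finset.univ : Finset κ).card := by rwa [Finset.card_univ]
  obtain ⟨s, -, hs⟩ := Finset.exists_subset_card_eq hcard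
  refine ⟨_, Pi.single s 1, ?_, ?_, rfl⟩
  · intro s' hs'
    rw [Pi.single_apply, if_neg]
    rintro rfl
    exact hs' hs
  · rw [dotProduct_single, Pi.star_apply, Pi.single_eq_same, star_one, one_mul]

/-- The variational set of a sector is bounded below. [folklore] -/
theorem groundEnergySet_bddBelow (H : Matrix (Finset κ) (Finset κ) ℂ) (N : ℕ) :
    BddBelow {E : ℝ | ∃ ψ : Fock κ, IsNParticle N ψ ∧ star ψ ⬝ᵥ ψ = 1 ∧ E = (expect H ψ).re} := by
  refine ⟨-(∑ s, ∑ t, ‖H s t‖), ?_⟩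
  rintro E ⟨ψ, -, hψ1, rfl⟩
  exact neg_sum_norm_le_re_expect H hψ1

/-- The sector ground energy is a lower bound for the energy of every unit trial vector of the
sector (variational principle for the `sInf`). [folklore] -/
theorem groundEnergy_le_re_expect (H : Matrix (Finset κ) (Finset κ) ℂ) {N : ℕ} {ψ : Fock κ}
    (hψN : IsNParticle N ψ) (hψ1 : star ψ ⬝ᵥ ψ = 1) : groundEnergy H N ≤ (expect H ψ).re :=
  csInf_le (groundEnergySet_bddBelow H N) ⟨ψ, hψN, hψ1, rfl⟩

/-- Approximate minimisers exist in a nonempty sector. [folklore] -/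
theorem exists_re_expect_lt (H : Matrix (Finset κ) (Finset κ) ℂ) {N : ℕ} (hN : N ≤ Fintype.card κ)
    {b : ℝ} (hb : groundEnergy H N < b) :
    ∃ ψ : Fock κ, IsNParticle N ψ ∧ star ψ ⬝ᵥ ψ = 1 ∧ (expect H ψ).re < b := by
  obtain ⟨E, ⟨ψ, hψN, hψ1, rfl⟩, hE⟩ := exists_lt_of_csInf_lt (groundEnergySet_nonempty H hN) hb
  exact ⟨ψ, hψN, hψ1, hE⟩

end Sector

end Literature.MathematicalPhysics.QuantumLattice.ThermodynamicLimit

namespace Literature.MathematicalPhysics.QuantumLattice.ThermodynamicLimit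


section Cut

variable {Λ₁ Λ₂ Λ : Type*} [LinearOrder Λ₁] [Fintype Λ₁] [LinearOrder Λ₂] [Fintype Λ₂]
  [LinearOrder Λ] [Fintype Λ]

omit [Fintype Λ₁] [Fintype Λ] in
/-- A strictly monotone map of sites induces a strictly monotone map of orbitals
`(x, σ) ↦ (e x, σ)` for the site-major lexicographic orders. [folklore] -/
theorem strictMono_orbMap {e : Λ₁ → Λ} (he : StrictMono e) :
    StrictMono (fun p : Orb Λ₁ => orb (e (ofLex p).1) (ofLex p).2) := by
  intro p q hpq
  have h : (ofLex p).1 < (ofLex q).1 ∨ (ofLex p).1 = (ofLex q).1 ∧ (ofLex p).2 < (ofLex q).2 := by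
    rw [← Prod.Lex.toLex_lt_toLex]
    simpa using hpq
  change toLex (e (ofLex p).1, (ofLex p).2) < toLex (e (ofLex q).1, (ofLex q).2)
  rw [Prod.Lex.toLex_lt_toLex]
  rcases h with h | ⟨h1, h2⟩
  · exact Or.inl (he h)
  · exact Or.inr ⟨by rw [h1], h2⟩

omit [LinearOrder Λ₁] [Fintype Λ₁] [LinearOrder Λ₂] [Fintype Λ₂] [Fintype Λ] in
/-- Orbitals of the lower block precede orbitals of the upper block. [folklore] -/
theorem orbMap_lt_orbMap {e₁ : Λ₁ → Λ} {e₂ : Λ₂ → Λ} (h12 : ∀ x y, e₁ x < e₂ y) (p : Orb Λ₁)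
    (q : Orb Λ₂) : orb (e₁ (ofLex p).1) (ofLex p).2 < orb (e₂ (ofLex q).1) (ofLex q).2 :=
  Prod.Lex.toLex_lt_toLex.2 (Or.inl (h12 _ _))

omit [LinearOrder Λ₁] [Fintype Λ₁] [LinearOrder Λ₂] [Fintype Λ₂] [LinearOrder Λ] [Fintype Λ] in
/-- The orbitals of the two blocks cover all orbitals. [folklore] -/
theorem orbMap_cover {e₁ : Λ₁ → Λ} {e₂ : Λ₂ → Λ} (hcov : ∀ z, (∃ x, e₁ x = z) ∨ ∃ y, e₂ y = z)
    (r : Orb Λ) :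
    (∃ p : Orb Λ₁, orb (e₁ (ofLex p).1) (ofLex p).2 = r) ∨
      ∃ q : Orb Λ₂, orb (e₂ (ofLex q).1) (ofLex q).2 = r := by
  rcases hcov (ofLex r).1 with ⟨x, hx⟩ | ⟨y, hy⟩
  · refine Or.inl ⟨orb x (ofLex r).2, ?_⟩
    change toLex (e₁ x, (ofLex r).2) = r
    rw [hx]
    exact toLex_ofLex r
  · refine Or.inr ⟨orb y (ofLex r).2, ?_⟩
    change toLex (e₂ y, (ofLex r).2) = r
    rw [hy]
    exact toLex_ofLex r

omit [LinearOrder Λ₁] [Fintype Λ₁] [LinearOrder Λ₂] [Fintype Λ₂] [LinearOrder Λ] [Fintype Λ] in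
/-- A condition independent of the spin can be pulled out of the spin sum. [folklore] -/
theorem sum_ite_const_cond (P : Prop) [Decidable P] (F : Fin 2 → ℂ) :
    (∑ σ, if P then F σ else 0) = if P then ∑ σ, F σ else 0 := by
  split_ifs <;> simp

variable (G₁ : SimpleGraph Λ₁) (G₂ : SimpleGraph Λ₂) (G : SimpleGraph Λ) [DecidableRel G₁.Adj]
  [DecidableRel G₂.Adj] [DecidableRel G.Adj]

/-- **Almost-subadditivity of sector ground-state energies under a cut.** Let the sites of `G` be
the ordered disjoint union of those of `G₁` (below) and `G₂` (above) along strictly monotone maps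
`e₁`, `e₂`, and suppose the adjacency of `G` restricted to the block `i` differs from that of `G_i`
on at most `k_i` ordered pairs. Then for all `t`, `U` and nonempty sectors `N_i ≤ 2|Λ_i|`,
`E_G(N₁ + N₂) ≤ E_{G₁}(N₁) + E_{G₂}(N₂) + 2|t|(k₁ + k₂)`.
Proof: the graded tensor product `ψ₁ ⊗ ψ₂` of unit trial vectors is a unit trial vector of the
sector `N₁ + N₂`; hopping terms across the cut have zero expectation, terms inside a block
reproduce `⟨ψ_i, · ψ_i⟩`, and each of the `≤ k₁ + k₂` bonds present in only one of the two
adjacency patterns contributes at most `2|t|` (two spins, `|⟨c_a ψ, c_b ψ⟩| ≤ 1`).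
(The standard first half of the existence proof of the thermodynamic limit, e.g. Ruelle,
*Statistical Mechanics* (1969) §2; here for lattice fermions.) [folklore] -/
theorem groundEnergyAt_le_add_of_cut {e₁ : Λ₁ → Λ} {e₂ : Λ₂ → Λ} (he₁ : StrictMono e₁)
    (he₂ : StrictMono e₂) (h12 : ∀ x y, e₁ x < e₂ y) (hcov : ∀ z, (∃ x, e₁ x = z) ∨ ∃ y, e₂ y = z)
    {k₁ k₂ : ℕ} (hk₁ : #{p : Λ₁ × Λ₁ | ¬ (G.Adj (e₁ p.1) (e₁ p.2) ↔ G₁.Adj p.1 p.2)} ≤ k₁)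
    (hk₂ : #{p : Λ₂ × Λ₂ | ¬ (G.Adj (e₂ p.1) (e₂ p.2) ↔ G₂.Adj p.1 p.2)} ≤ k₂) (t U : ℝ)
    {N₁ N₂ : ℕ} (hN₁ : N₁ ≤ 2 * Fintype.card Λ₁) (hN₂ : N₂ ≤ 2 * Fintype.card Λ₂) :
    groundEnergyAt G t U (N₁ + N₂) ≤
      groundEnergyAt G₁ t U N₁ + groundEnergyAt G₂ t U N₂ + 2 * |t| * (k₁ + k₂) := by
  -- orbital maps
  set O₁ : Orb Λ₁ → Orb Λ := fun p => orb (e₁ (ofLex p).1) (ofLex p).2 with hO₁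
  set O₂ : Orb Λ₂ → Orb Λ := fun q => orb (e₂ (ofLex q).1) (ofLex q).2 with hO₂
  have hO₁m : StrictMono O₁ := strictMono_orbMap he₁
  have hO₂m : StrictMono O₂ := strictMono_orbMap he₂
  have hO12 : ∀ p q, O₁ p < O₂ q := orbMap_lt_orbMap h12
  have hOcov : ∀ r, (∃ p, O₁ p = r) ∨ ∃ q, O₂ q = r := orbMap_cover hcov
  have hOne : ∀ p q, O₁ p ≠ O₂ q := fun p q => (hO12 p q).ne
  have he₁i : Function.Injective e₁ := he₁.injective
  have he₂i : Function.Injective e₂ := he₂.injective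
  have hene : ∀ x y, e₁ x ≠ e₂ y := fun x y => (h12 x y).ne
  -- the estimate for product trial states
  have main : ∀ (ψ₁ : Fock (Orb Λ₁)) (ψ₂ : Fock (Orb Λ₂)), IsNParticle N₁ ψ₁ → IsNParticle N₂ ψ₂ →
      star ψ₁ ⬝ᵥ ψ₁ = 1 → star ψ₂ ⬝ᵥ ψ₂ = 1 →
      groundEnergyAt G t U (N₁ + N₂) ≤ (star ψ₁ ⬝ᵥ (hamiltonian G₁ t U *ᵥ ψ₁)).re +
        (star ψ₂ ⬝ᵥ (hamiltonian G₂ t U *ᵥ ψ₂)).re + 2 * |t| * (k₁ + k₂) := by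
    intro ψ₁ ψ₂ hψ₁N hψ₂N hψ₁ hψ₂
    set Ψ : Fock (Orb Λ) := fun s => ψ₁ {p | O₁ p ∈ s} * ψ₂ {q | O₂ q ∈ s} with hΨ
    have hΨ1 : star Ψ ⬝ᵥ Ψ = 1 := by
      rw [hΨ, dotProduct_prodVec hO₁m.injective hO₂m.injective hOne hOcov, hψ₁, hψ₂, one_mul]
    have hΨN : IsNParticle (N₁ + N₂) Ψ := isNParticle_prodVec hO₁m hO₂m hO12 hOcov hψ₁N hψ₂N
    have hE : groundEnergyAt G t U (N₁ + N₂) ≤ (star Ψ ⬝ᵥ (hamiltonian G t U *ᵥ Ψ)).re :=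
      groundEnergy_le_re_expect _ hΨN hΨ1
    -- block amplitudes
    set F₁ : Λ₁ → Λ₁ → Fin 2 → ℂ := fun x x' σ =>
      star (annihilation (orb x σ) *ᵥ ψ₁) ⬝ᵥ (annihilation (orb x' σ) *ᵥ ψ₁) with hF₁
    set F₂ : Λ₂ → Λ₂ → Fin 2 → ℂ := fun y y' σ =>
      star (annihilation (orb y σ) *ᵥ ψ₂) ⬝ᵥ (annihilation (orb y' σ) *ᵥ ψ₂) with hF₂
    set D₁ : Λ₁ → ℂ := fun x => star ψ₁ ⬝ᵥ (numberOp x 0 *ᵥ (numberOp x 1 *ᵥ ψ₁)) with hD₁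
    set D₂ : Λ₂ → ℂ := fun y => star ψ₂ ⬝ᵥ (numberOp y 0 *ᵥ (numberOp y 1 *ᵥ ψ₂)) with hD₂
    have hF11 : ∀ x x' σ, star (annihilation (orb (e₁ x) σ) *ᵥ Ψ) ⬝ᵥ
        (annihilation (orb (e₁ x') σ) *ᵥ Ψ) = F₁ x x' σ := by
      intro x x' σ
      have h := dotProduct_annihilation_low_low hO₁m hO₂m hO12 hOcov ψ₁ ψ₂ (orb x σ) (orb x' σ)
      rw [hψ₂, mul_one] at h
      exact h
    have hF22 : ∀ y y' σ, star (annihilation (orb (e₂ y) σ) *ᵥ Ψ) ⬝ᵥ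
        (annihilation (orb (e₂ y') σ) *ᵥ Ψ) = F₂ y y' σ := by
      intro y y' σ
      have h := dotProduct_annihilation_high_high hO₁m hO₂m hO12 hOcov ψ₁ ψ₂ (orb y σ) (orb y' σ)
      rw [hψ₁, one_mul] at h
      exact h
    have hF12 : ∀ x y σ, star (annihilation (orb (e₁ x) σ) *ᵥ Ψ) ⬝ᵥ
        (annihilation (orb (e₂ y) σ) *ᵥ Ψ) = 0 := fun x y σ =>
      dotProduct_annihilation_low_high hO₁m hO₂m hO12 hOcov hψ₁N ψ₂ (orb x σ) (orb y σ)
    have hF21 : ∀ y x σ, star (annihilation (orb (e₂ y) σ) *ᵥ Ψ) ⬝ᵥ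
        (annihilation (orb (e₁ x) σ) *ᵥ Ψ) = 0 := fun y x σ =>
      dotProduct_annihilation_high_low hO₁m hO₂m hO12 hOcov hψ₁N ψ₂ (orb x σ) (orb y σ)
    have hD1 : ∀ x, star Ψ ⬝ᵥ (numberOp (e₁ x) 0 *ᵥ (numberOp (e₁ x) 1 *ᵥ Ψ)) = D₁ x := by
      intro x
      have h := dotProduct_numberAt_numberAt_low hO₁m hO₂m hO12 hOcov ψ₁ ψ₂ (orb x 0) (orb x 1)
      rw [hψ₂, mul_one] at h
      exact h
    have hD2 : ∀ y, star Ψ ⬝ᵥ (numberOp (e₂ y) 0 *ᵥ (numberOp (e₂ y) 1 *ᵥ Ψ)) = D₂ y := by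
      intro y
      have h := dotProduct_numberAt_numberAt_high hO₁m hO₂m hO12 hOcov ψ₁ ψ₂ (orb y 0) (orb y 1)
      rw [hψ₁, one_mul] at h
      exact h
    -- the hopping sums
    set A₁' : ℂ := ∑ x, ∑ x', if G.Adj (e₁ x) (e₁ x') then ∑ σ, F₁ x x' σ else 0 with hA₁'
    set A₂' : ℂ := ∑ y, ∑ y', if G.Adj (e₂ y) (e₂ y') then ∑ σ, F₂ y y' σ else 0 with hA₂'
    set A₁ : ℂ := ∑ x, ∑ x', if G₁.Adj x x' then ∑ σ, F₁ x x' σ else 0 with hA₁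
    set A₂ : ℂ := ∑ y, ∑ y', if G₂.Adj y y' then ∑ σ, F₂ y y' σ else 0 with hA₂
    have hbig : star Ψ ⬝ᵥ (hamiltonian G t U *ᵥ Ψ) =
        -(t : ℂ) * (A₁' + A₂') + (U : ℂ) * (∑ x, D₁ x + ∑ y, D₂ y) := by
      rw [dotProduct_hamiltonian_mulVec]
      congr 2
      · rw [sum_eq_sum_add_sum_of_cut he₁i he₂i hene hcov]
        congr 1
        · refine Finset.sum_congr rfl fun x _ => ?_
          rw [sum_eq_sum_add_sum_of_cut he₁i he₂i hene hcov]
          simp only [hF11, hF12, ite_self, Finset.sum_const_zero, add_zero, sum_ite_const_cond]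
        · refine Finset.sum_congr rfl fun y _ => ?_
          rw [sum_eq_sum_add_sum_of_cut he₁i he₂i hene hcov]
          simp only [hF22, hF21, ite_self, Finset.sum_const_zero, zero_add, sum_ite_const_cond]
      · rw [sum_eq_sum_add_sum_of_cut he₁i he₂i hene hcov]
        simp only [hD1, hD2]
    have hone : star ψ₁ ⬝ᵥ (hamiltonian G₁ t U *ᵥ ψ₁) = -(t : ℂ) * A₁ + (U : ℂ) * ∑ x, D₁ x := by
      rw [dotProduct_hamiltonian_mulVec]
      simp only [sum_ite_const_cond, hA₁, hF₁, hD₁]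
    have htwo : star ψ₂ ⬝ᵥ (hamiltonian G₂ t U *ᵥ ψ₂) = -(t : ℂ) * A₂ + (U : ℂ) * ∑ y, D₂ y := by
      rw [dotProduct_hamiltonian_mulVec]
      simp only [sum_ite_const_cond, hA₂, hF₂, hD₂]
    -- the few differing bonds
    have hbF₁ : ∀ x x', ‖∑ σ, F₁ x x' σ‖ ≤ 2 := by
      intro x x'
      calc ‖∑ σ, F₁ x x' σ‖ ≤ ∑ σ, ‖F₁ x x' σ‖ := norm_sum_le _ _
        _ ≤ ∑ _σ : Fin 2, (1 : ℝ) := Finset.sum_le_sum fun σ _ =>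
            norm_dotProduct_annihilation_le_one hψ₁ _ _
        _ = 2 := by simp
    have hbF₂ : ∀ y y', ‖∑ σ, F₂ y y' σ‖ ≤ 2 := by
      intro y y'
      calc ‖∑ σ, F₂ y y' σ‖ ≤ ∑ σ, ‖F₂ y y' σ‖ := norm_sum_le _ _
        _ ≤ ∑ _σ : Fin 2, (1 : ℝ) := Finset.sum_le_sum fun σ _ =>
            norm_dotProduct_annihilation_le_one hψ₂ _ _
        _ = 2 := by simp
    have hΔ₁ : ‖A₁' - A₁‖ ≤ k₁ * 2 :=
      norm_sum_ite_sub_sum_ite_le (fun x x' => G.Adj (e₁ x) (e₁ x')) G₁.Adj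
        (fun x x' => ∑ σ, F₁ x x' σ) zero_le_two hbF₁ hk₁
    have hΔ₂ : ‖A₂' - A₂‖ ≤ k₂ * 2 :=
      norm_sum_ite_sub_sum_ite_le (fun y y' => G.Adj (e₂ y) (e₂ y')) G₂.Adj
        (fun y y' => ∑ σ, F₂ y y' σ) zero_le_two hbF₂ hk₂
    have key : ∀ w : ℂ, (-(t : ℂ) * w).re ≤ |t| * ‖w‖ := fun w =>
      (Complex.re_le_norm _).trans (by rw [norm_mul, norm_neg, Complex.norm_real, Real.norm_eq_abs])
    have hsplit : -(t : ℂ) * (A₁' + A₂') + (U : ℂ) * (∑ x, D₁ x + ∑ y, D₂ y) =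
        (-(t : ℂ) * A₁ + (U : ℂ) * ∑ x, D₁ x) + (-(t : ℂ) * A₂ + (U : ℂ) * ∑ y, D₂ y) +
          (-(t : ℂ) * (A₁' - A₁)) + (-(t : ℂ) * (A₂' - A₂)) := by ring
    rw [hbig, hsplit, Complex.add_re, Complex.add_re, Complex.add_re] at hE
    rw [hone, htwo]
    have h1 := key (A₁' - A₁)
    have h2 := key (A₂' - A₂)
    have h3 : |t| * ‖A₁' - A₁‖ ≤ |t| * (k₁ * 2) := mul_le_mul_of_nonneg_left hΔ₁ (abs_nonneg t)
    have h4 : |t| * ‖A₂' - A₂‖ ≤ |t| * (k₂ * 2) := mul_le_mul_of_nonneg_left hΔ₂ (abs_nonneg t)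
    linarith
  -- pass to the infima
  have hc₁ : N₁ ≤ Fintype.card (Orb Λ₁) := by rw [card_orb]; exact hN₁
  have hc₂ : N₂ ≤ Fintype.card (Orb Λ₂) := by rw [card_orb]; exact hN₂
  refine le_of_forall_pos_lt_add fun ε hε => ?_
  obtain ⟨ψ₁, hψ₁N, hψ₁, hlt₁⟩ := exists_re_expect_lt (hamiltonian G₁ t U) hc₁
    (show groundEnergyAt G₁ t U N₁ < groundEnergyAt G₁ t U N₁ + ε / 2 by linarith)
  obtain ⟨ψ₂, hψ₂N, hψ₂, hlt₂⟩ := exists_re_expect_lt (hamiltonian G₂ t U) hc₂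
    (show groundEnergyAt G₂ t U N₂ < groundEnergyAt G₂ t U N₂ + ε / 2 by linarith)
  have h := main ψ₁ ψ₂ hψ₁N hψ₂N hψ₁ hψ₂
  unfold QuantumLattice.expect at hlt₁ hlt₂
  linarith

end Cut

end Literature.MathematicalPhysics.QuantumLattice.ThermodynamicLimit


/-! ### The Hubbard ring: subadditivity, a priori bounds, and the thermodynamic limit -/

namespace Literature.MathematicalPhysics.QuantumLattice.ThermodynamicLimit

open Filter Topology

section RingLimit

/-- Coordinate of the lower-block embedding `x ↦ x` of the ring of `L₁` sites into the ring of
`L₁ + L₂` sites. [folklore] -/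
theorem ofLex_ringCastAdd (L₁ L₂ : ℕ) (x : FermionTorus 1 L₁) :
    (ofLex (toLex fun _ : Fin 1 => Fin.castAdd L₂ (ofLex x 0)) 0 : ℕ) = ofLex x 0 := by
  simp

/-- Coordinate of the upper-block embedding `y ↦ L₁ + y`. [folklore] -/
theorem ofLex_ringNatAdd (L₁ L₂ : ℕ) (y : FermionTorus 1 L₂) :
    (ofLex (toLex fun _ : Fin 1 => Fin.natAdd L₁ (ofLex y 0)) 0 : ℕ) = L₁ + ofLex y 0 := by
  simp

/-- **The ring cut.** Cutting the Hubbard ring of `L₁ + L₂` sites into the rings of `L₁` and `L₂`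
sites costs at most `8|t|`: `E_{L₁+L₂}(N₁ + N₂) ≤ E_{L₁}(N₁) + E_{L₂}(N₂) + 8|t|` for
`N_i ≤ 2 L_i` (the two adjacency patterns differ on at most the two ordered wrap-around pairs of
each block). [folklore] -/
theorem groundEnergyAt_ring_le_add (L₁ L₂ : ℕ) (t U : ℝ) {N₁ N₂ : ℕ} (hN₁ : N₁ ≤ 2 * L₁)
    (hN₂ : N₂ ≤ 2 * L₂) :
    groundEnergyAt (fermionTorusGraph 1 (L₁ + L₂)) t U (N₁ + N₂) ≤
      groundEnergyAt (fermionTorusGraph 1 L₁) t U N₁ +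
        groundEnergyAt (fermionTorusGraph 1 L₂) t U N₂ + 8 * |t| := by
  set e₁ : FermionTorus 1 L₁ → FermionTorus 1 (L₁ + L₂) :=
    fun x => toLex fun _ : Fin 1 => Fin.castAdd L₂ (ofLex x 0) with he₁def
  set e₂ : FermionTorus 1 L₂ → FermionTorus 1 (L₁ + L₂) :=
    fun y => toLex fun _ : Fin 1 => Fin.natAdd L₁ (ofLex y 0) with he₂def
  have hv₁ : ∀ x, (ofLex (e₁ x) 0 : ℕ) = ofLex x 0 := fun x => ofLex_ringCastAdd L₁ L₂ x
  have hv₂ : ∀ y, (ofLex (e₂ y) 0 : ℕ) = L₁ + ofLex y 0 := fun y => ofLex_ringNatAdd L₁ L₂ y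
  -- the order on the ring sites is the order of the coordinate values (`Pi.Lex.lt_iff_of_unique`)
  have fermionTorus_one_lt_iff : ∀ {M : ℕ} (u v : FermionTorus 1 M),
      u < v ↔ (ofLex u 0 : ℕ) < (ofLex v 0 : ℕ) :=
    fun u v => Pi.Lex.lt_iff_of_unique.trans Fin.lt_def
  have he₁ : StrictMono e₁ := by
    intro x x' h
    rw [fermionTorus_one_lt_iff] at h ⊢
    rw [hv₁, hv₁]
    exact h
  have he₂ : StrictMono e₂ := by
    intro y y' h
    rw [fermionTorus_one_lt_iff] at h ⊢
    rw [hv₂, hv₂]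
    omega
  have h12 : ∀ x y, e₁ x < e₂ y := by
    intro x y
    rw [fermionTorus_one_lt_iff, hv₁, hv₂]
    have := (ofLex x 0).isLt
    omega
  have hcov : ∀ z, (∃ x, e₁ x = z) ∨ ∃ y, e₂ y = z := by
    intro z
    obtain ⟨x | y, h⟩ := finSumFinEquiv.surjective (ofLex z 0)
    · refine Or.inl ⟨toLex fun _ => x, fermionTorus_one_ext ?_⟩
      rw [he₁def]
      simpa using h
    · refine Or.inr ⟨toLex fun _ => y, fermionTorus_one_ext ?_⟩
      rw [he₂def]
      simpa using h
  have hk₁ : #{p : FermionTorus 1 L₁ × FermionTorus 1 L₁ |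
      ¬ ((fermionTorusGraph 1 (L₁ + L₂)).Adj (e₁ p.1) (e₁ p.2) ↔
        (fermionTorusGraph 1 L₁).Adj p.1 p.2)} ≤ 2 := by
    calc _ ≤ #({(0, L₁ - 1), (L₁ - 1, 0)} : Finset (ℕ × ℕ)) := by
          refine Finset.card_le_card_of_injOn (fun p => ((ofLex p.1 0 : ℕ), (ofLex p.2 0 : ℕ)))
            ?_ ?_
          · intro p hp
            rw [Finset.mem_coe, Finset.mem_filter, fermionTorusGraph_one_adj_iff,
              fermionTorusGraph_one_adj_iff, hv₁, hv₁] at hp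
            have hw := cut_low_wrap (ofLex p.1 0).isLt (ofLex p.2 0).isLt hp.2
            rw [Finset.coe_insert, Finset.coe_singleton, Set.mem_insert_iff,
              Set.mem_singleton_iff]
            rcases hw with ⟨h1, h2⟩ | ⟨h1, h2⟩
            · exact Or.inl (Prod.ext h1 h2)
            · exact Or.inr (Prod.ext h1 h2)
          · intro p _ q _ h
            simp only [Prod.mk.injEq] at h
            exact Prod.ext (fermionTorus_one_ext_val h.1) (fermionTorus_one_ext_val h.2)
      _ ≤ 2 := Finset.card_le_two
  have hk₂ : #{p : FermionTorus 1 L₂ × FermionTorus 1 L₂ |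
      ¬ ((fermionTorusGraph 1 (L₁ + L₂)).Adj (e₂ p.1) (e₂ p.2) ↔
        (fermionTorusGraph 1 L₂).Adj p.1 p.2)} ≤ 2 := by
    calc _ ≤ #({(0, L₂ - 1), (L₂ - 1, 0)} : Finset (ℕ × ℕ)) := by
          refine Finset.card_le_card_of_injOn (fun p => ((ofLex p.1 0 : ℕ), (ofLex p.2 0 : ℕ)))
            ?_ ?_
          · intro p hp
            rw [Finset.mem_coe, Finset.mem_filter, fermionTorusGraph_one_adj_iff,
              fermionTorusGraph_one_adj_iff, hv₂, hv₂] at hp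
            have hw := cut_high_wrap (ofLex p.1 0).isLt (ofLex p.2 0).isLt hp.2
            rw [Finset.coe_insert, Finset.coe_singleton, Set.mem_insert_iff,
              Set.mem_singleton_iff]
            rcases hw with ⟨h1, h2⟩ | ⟨h1, h2⟩
            · exact Or.inl (Prod.ext h1 h2)
            · exact Or.inr (Prod.ext h1 h2)
          · intro p _ q _ h
            simp only [Prod.mk.injEq] at h
            exact Prod.ext (fermionTorus_one_ext_val h.1) (fermionTorus_one_ext_val h.2)
      _ ≤ 2 := Finset.card_le_two
  have h := groundEnergyAt_le_add_of_cut (fermionTorusGraph 1 L₁) (fermionTorusGraph 1 L₂)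
    (fermionTorusGraph 1 (L₁ + L₂)) he₁ he₂ h12 hcov hk₁ hk₂ t U
    (N₁ := N₁) (N₂ := N₂) (by simpa [FermionTorus, Fintype.card_lex] using hN₁)
    (by simpa [FermionTorus, Fintype.card_lex] using hN₂)
  have : (2 : ℝ) * |t| * ((2 : ℕ) + (2 : ℕ)) = 8 * |t| := by push_cast; ring
  linarith

/-- **A priori lower bound.** On the ring of `L` sites with `U ≥ 0`, every nonempty sector has
`E_L(N) ≥ -4|t| L` (each of the `≤ 2L` ordered bonds contributes `≥ -2|t|`, the interaction is
nonnegative). [folklore] -/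
theorem neg_le_groundEnergyAt_ring (L : ℕ) (t : ℝ) {U : ℝ} (hU : 0 ≤ U) {N : ℕ} (hN : N ≤ 2 * L) :
    -(4 * |t| * L) ≤ groundEnergyAt (fermionTorusGraph 1 L) t U N := by
  have hc : N ≤ Fintype.card (Orb (FermionTorus 1 L)) := by
    rw [card_orb]; simpa [FermionTorus, Fintype.card_lex] using hN
  refine le_csInf (groundEnergySet_nonempty _ hc) ?_
  rintro E ⟨ψ, -, hψ1, rfl⟩
  unfold QuantumLattice.expect
  rw [dotProduct_hamiltonian_mulVec, Complex.add_re]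
  set A : ℂ := ∑ x, ∑ y, ∑ σ : Fin 2, if (fermionTorusGraph 1 L).Adj x y then
      star (annihilation (orb x σ) *ᵥ ψ) ⬝ᵥ (annihilation (orb y σ) *ᵥ ψ) else 0 with hA
  -- the hopping part
  have hAn : ‖A‖ ≤ 2 * (2 * L) := by
    calc ‖A‖ ≤ ∑ x, ‖∑ y, ∑ σ : Fin 2, if (fermionTorusGraph 1 L).Adj x y then
            star (annihilation (orb x σ) *ᵥ ψ) ⬝ᵥ (annihilation (orb y σ) *ᵥ ψ) else 0‖ :=
          norm_sum_le _ _
      _ ≤ ∑ x, ∑ y, ‖∑ σ : Fin 2, if (fermionTorusGraph 1 L).Adj x y then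
            star (annihilation (orb x σ) *ᵥ ψ) ⬝ᵥ (annihilation (orb y σ) *ᵥ ψ) else 0‖ :=
          Finset.sum_le_sum fun x _ => norm_sum_le _ _
      _ ≤ ∑ x, ∑ y, (if (fermionTorusGraph 1 L).Adj x y then (2 : ℝ) else 0) := by
          refine Finset.sum_le_sum fun x _ => Finset.sum_le_sum fun y _ => ?_
          split_ifs with h
          · calc _ ≤ ∑ σ : Fin 2, ‖star (annihilation (orb x σ) *ᵥ ψ) ⬝ᵥ
                    (annihilation (orb y σ) *ᵥ ψ)‖ := norm_sum_le _ _
              _ ≤ ∑ _σ : Fin 2, (1 : ℝ) := Finset.sum_le_sum fun σ _ =>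
                    norm_dotProduct_annihilation_le_one hψ1 _ _
              _ = 2 := by simp
          · simp
      _ = 2 * #{p : FermionTorus 1 L × FermionTorus 1 L | (fermionTorusGraph 1 L).Adj p.1 p.2} := by
          rw [← Fintype.sum_prod_type' (f := fun x y =>
            if (fermionTorusGraph 1 L).Adj x y then (2 : ℝ) else 0)]
          rw [← Finset.sum_boole, Finset.mul_sum]
          exact Finset.sum_congr rfl fun p _ => by split_ifs <;> simp
      _ ≤ 2 * (2 * L) := by
          have h := card_filter_fermionTorusGraph_one_adj_pair_le (L := L)
          exact_mod_cast Nat.mul_le_mul_left 2 h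
  have h1 : -(4 * |t| * L) ≤ (-(t : ℂ) * A).re := by
    have h2 : |(-(t : ℂ) * A).re| ≤ |t| * ‖A‖ :=
      (Complex.abs_re_le_norm _).trans_eq (by rw [norm_mul, norm_neg, Complex.norm_real,
        Real.norm_eq_abs])
    have h3 : |t| * ‖A‖ ≤ |t| * (2 * (2 * L)) := mul_le_mul_of_nonneg_left hAn (abs_nonneg t)
    have h4 := neg_le_of_abs_le h2
    linarith
  -- the interaction part
  have h5 : 0 ≤ ((U : ℂ) * ∑ x, star ψ ⬝ᵥ (numberOp x 0 *ᵥ (numberOp x 1 *ᵥ ψ))).re := by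
    rw [Complex.re_ofReal_mul, Complex.re_sum]
    exact mul_nonneg hU (Finset.sum_nonneg fun x _ => re_dotProduct_numberOp_numberOp_nonneg ψ x)
  linarith

/-- **Existence of the thermodynamic limit of the half-filled Hubbard ring** (all `t`, `U ≥ 0`):
`E_L(L)/L` converges as `L → ∞`. Proof: `u(L) = E_L(L) + 8|t|` is subadditive by the ring cut
(`groundEnergyAt_ring_le_add`) and `u(L)/L ≥ -4|t|`, so Fekete's lemma (Mathlib
`Subadditive.tendsto_lim`) applies; `8|t|/L → 0`. (Ruelle, *Statistical Mechanics* (1969) §2.)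
[folklore] -/
theorem tendsto_energyPerSite_ring (t : ℝ) {U : ℝ} (hU : 0 ≤ U) :
    ∃ e : ℝ, Tendsto (fun L : ℕ => energyPerSite (fermionTorusGraph 1 L) t U L) atTop (𝓝 e) := by
  set u : ℕ → ℝ := fun L => groundEnergyAt (fermionTorusGraph 1 L) t U L + 8 * |t| with hu
  have hsub : Subadditive u := by
    intro m n
    have h := groundEnergyAt_ring_le_add m n t U (N₁ := m) (N₂ := n) (by omega) (by omega)
    simp only [hu]
    linarith
  have hbdd : BddBelow (Set.range fun n => u n / n) := by
    refine ⟨-(4 * |t|), ?_⟩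
    rintro _ ⟨n, rfl⟩
    rcases Nat.eq_zero_or_pos n with rfl | hn
    · simp
    · have h := neg_le_groundEnergyAt_ring n t hU (N := n) (by omega)
      have hn' : (0 : ℝ) < n := by exact_mod_cast hn
      rw [le_div_iff₀ hn', hu]
      have : 0 ≤ |t| := abs_nonneg t
      nlinarith
  refine ⟨hsub.lim, ?_⟩
  have hlim := hsub.tendsto_lim hbdd
  have h0 : Tendsto (fun L : ℕ => (8 * |t|) / (L : ℝ)) atTop (𝓝 0) :=
    tendsto_const_div_atTop_nhds_zero_nat _
  have heq : (fun L : ℕ => energyPerSite (fermionTorusGraph 1 L) t U L) =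
      fun L : ℕ => u L / L - (8 * |t|) / L := by
    funext L
    have hcard : Fintype.card (FermionTorus 1 L) = L := by simp [FermionTorus, Fintype.card_lex]
    rw [energyPerSite, hcard, hu]
    ring
  rw [heq, ← sub_zero hsub.lim]
  exact hlim.sub h0

/-- The same limit along the even rings `L = 2n` (the setting of `Literature.MathematicalPhysics.QuantumLattice.lieb_wu`;
`hubbardChain L = fermionTorusGraph 1 L`): this is the statement of the named fact
`Literature.MathematicalPhysics.QuantumLattice.hubbardChain_energyPerSite_limit_exists` (F4 of the Lieb–Wu decomposition) for
`t = 1`. [folklore] -/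
theorem hubbardRing_energyPerSite_limit_exists (t : ℝ) {U : ℝ} (hU : 0 ≤ U) :
    ∃ e : ℝ, Tendsto (fun n : ℕ => energyPerSite (fermionTorusGraph 1 (2 * n)) t U (2 * n)) atTop
      (𝓝 e) := by
  obtain ⟨e, he⟩ := tendsto_energyPerSite_ring t hU
  have h2 : Tendsto (fun n : ℕ => 2 * n) atTop atTop :=
    tendsto_atTop_atTop.2 fun b => ⟨b, fun a ha => by omega⟩
  exact ⟨e, he.comp h2⟩

end RingLimit

end Literature.MathematicalPhysics.QuantumLattice.ThermodynamicLimit
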